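import Mathlib
import Literature.NumberTheory.Irrationality.LaiSprangZudilin2026.TwoAdicLinearForms
import HarnessLib

/-!
# Lai–Sprang–Zudilin 2026, §6, Lemma 6.2: the 2-adic smallness `|S_n|₂ ≤ 2^{−16n+O(log n)}` — PROVED

Topic `Literature/NumberTheory/Irrationality/LaiSprangZudilin2026`.  Source: L. Lai, J. Sprang, W. Zudilin, *A note on the
irrationality of `ζ₂(5)`*, IMRN **2026**:16, rnag180 = arXiv:2505.05005 [LaiSprangZudilin2026], §6 "Asymptotic estimates",
Lemma 6.2 (held text `paper:arxiv-2505.05005`, chunk p0010, read on the page).  PROOF FILE (theorems + auxiliary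
definitions with bodies; no named fact, net debt 0); file 3 of the tree's discharge of [LaiSprangZudilin2026, Thm 1.1].

## Source, as printed (Lemma 6.2 and its proof)

"**Lemma 6.2.** We have `|S_n|₂ ≤ 2^{−16n+o(n)}` as `n → ∞`.  *Proof.* From Definition 3.1 we have
`R_n(t+½) = 2^{12n+4}·g(t)·∏_{j=1}^{n}(t+j)⁴`, where `g(t) = (2t+n+1)/∏_{j=0}^{n}(2t+2j+1)⁴`.  By the Leibniz rule we deduce
`R_n′(t+½) = 2^{12n+4}·g′(t)·∏_{j=1}^{n}(t+j)⁴ + 2^{12n+4}·g(t)·4·Σ_{j=1}^{n}(t+j)³∏_{k≠j}(t+k)⁴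
 = 2^{12n+4} n!⁴·g′(t)·binom(t+n,n)⁴ + 2^{12n+6} n!³·g(t)·binom(t+n,n)³ Σ_{j=1}^{n}(j−1)!(n−j)!binom(t+j−1,j−1)binom(t+n,n−j)`.
By part (d) of Lemma 2.6, we have `Δ(g) ≥ 0` and `Δ(g′) ≥ 0`.  By part (e), `Δ(binom(t+n,n)) ≥ −⌊log n/log 2⌋`,
`Δ(binom(t+j−1,j−1)) ≥ −⌊log n/log 2⌋` and `Δ(binom(t+n,n−j)) ≥ −⌊log n/log 2⌋` … Therefore, by part (c) … Now notice that
`v₂(n!) ≥ n − log(n+1)/log 2` and `v₂((j−1)!(n−j)!) ≥ n − 1 − 2log((n+1)/2)/log 2` … Thus, by parts (a), (b) …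
`Δ(R_n′(t+½)) ≥ 16n + 4 − 6 log(n+1)/log 2`.  Finally, by Definition 3.2 and Lemma 2.5, we have
`v₂(S_n) ≥ Δ(R_n′(t+½)) − 1`, which implies the asymptotics claimed."

## What is formalised (all PROVED; the constants are kept explicit, with `L = ⌊log₂ n⌋ = Nat.log 2 n`)

* §1 `Rhalf`, `R_add_half_eq` — `R_n(t+½) = 2^{12n+4}(2t+n+1)(∏_{j=1}^{n}(t+j))⁴/(∏_{j=0}^{n}(2t+2j+1))⁴`; `hasDerivAt_Rhalf`
  (the Leibniz rule, from Mathlib's product rule `HasDerivAt.finsetProd`) and, comparing with the partial-fraction derivative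
  `hasDerivAt_R_half` of `TwoAdicLinearForms.lean`, **`Dq_natCast_eq_leibniz`**: at every natural number `m` the integrand
  `D_n(m) = −R_n′(m+½)` equals `−2^{12n+4} W⁴ (2 n!⁴C⁴ + 4(2m+n+1) n!³ C³ Σ_{l<n} l!(n−1−l)! binom(m+l,l) binom(m+n,n−1−l)
  − 8(2m+n+1) n!⁴ C⁴ Σ_{j≤n} u_j)` with `u_j = (2m+2j+1)^{−1}`, `W = ∏_{j≤n} u_j`, `C = binom(m+n,n)` (the printed display, the
  factor `g′` expanded as `g′ = 2W⁴ − 8(2t+n+1)W⁴Σ_j u_j`; the index `j` of the print is `l + 1`).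
* §2 the valuations: `norm_factorial_le` — `‖n!‖₂ ≤ 2^{−(n − (L+1))}` i.e. `v₂(n!) = n − s₂(n) ≥ n − ⌊log₂ n⌋ − 1` (Legendre,
  Mathlib `sub_one_mul_padicValNat_factorial`); the Lipschitz constants of all the bracket functions are `≤ 2^L`
  (`VolkenbornDeltaOperator`: `lipNat_choose`, `lipNat_inv_linear`, `lipNat_linear`, closure under products).
* §3 **Lemma 6.2** with explicit constants: `G2` (the Leibniz form as a function `ℕ → ℚ₂`, `D_natCast_eq_neg_G2`) and
  `lipNat_G2` — `Δ(R_n′(t+½)) ≥ 16n − 5L` in the form `‖D_n(k+h) − D_n(k)‖₂ ≤ 2^{5L−16n}·2^{L}‖h‖₂`, `‖D_n(0)‖₂ ≤ 2^{5L−16n}`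
  (scalar norms `norm_cst₁_le`, `norm_cst₂_le`, `norm_cst₃_le`); hence (Lemma 2.5 = `norm_le_of_tendsto_volkenbornSum_of_lipNat`)
  **`norm_S_le : ‖S_n‖₂ ≤ 2^{6L+1−16n}`**, and the printed asymptotic form `norm_S_le_exp`: for every `ε > 0`, eventually
  `‖S_n‖₂ ≤ exp(−(16 log 2 − ε) n)`.

Cell zeta5-irr / pub-zeta5 (HONEST FRAMING: systematic search; no irrationality claim unless kernel-certified): a `2`-adic
estimate; nothing here bears on `ζ(5) ∈ ℝ`.
-/

noncomputable section

open Filter Finset Topology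
open Literature.NumberTheory.LocalFields
open Literature.NumberTheory.Irrationality.PAdicZetaValues
open scoped Nat

namespace Literature.NumberTheory.Irrationality.LaiSprangZudilin2026

/-! ## §1. `R_n(t+½)` in product form and the Leibniz rule -/

/-- `R_n(t+½) = 2^{12n+4}(2t+n+1)·(∏_{l<n}(t+1+l))⁴·((∏_{j≤n}(2t+2j+1))⁴)^{−1}` ("`= 2^{12n+4}·g(t)·∏_{j=1}^{n}(t+j)⁴`,
`g(t) = (2t+n+1)/∏_{j=0}^{n}(2t+2j+1)⁴`"). [cite: LaiSprangZudilin2026, Lemma 6.2 (proof, first display)] -/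
def Rhalf (n : ℕ) (t : ℚ) : ℚ :=
  2 ^ (12 * n + 4) * (2 * t + n + 1) * (∏ l ∈ range n, (t + 1 + l)) ^ 4 * ((∏ j ∈ range (n + 1), (2 * t + 2 * j + 1)) ^ 4)⁻¹

/-- `∏_{j≤n}(t+½+j) = (∏_{j≤n}(2t+2j+1))/2^{n+1}`. [cite: LaiSprangZudilin2026, Lemma 6.2 (proof, first display)] -/
theorem prod_add_half (n : ℕ) (t : ℚ) :
    ∏ j ∈ range (n + 1), (t + 1 / 2 + j) = (∏ j ∈ range (n + 1), (2 * t + 2 * j + 1)) / 2 ^ (n + 1) := by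
  rw [eq_div_iff (by positivity), show (2 : ℚ) ^ (n + 1) = ∏ j ∈ range (n + 1), (2 : ℚ) by simp,
    ← Finset.prod_mul_distrib]
  exact Finset.prod_congr rfl fun j _ => by ring

/-- **`R_n(t+½) = Rhalf n t`** (Definition 3.1 shifted by `½`). [cite: LaiSprangZudilin2026, Lemma 6.2 (proof, first display)] -/
theorem R_add_half_eq (n : ℕ) (t : ℚ) : R n (t + 1 / 2) = Rhalf n t := by
  rw [R, Rhalf]
  have h1 : ∏ j ∈ range n, (t + 1 / 2 + 1 / 2 + (j : ℚ)) = ∏ l ∈ range n, (t + 1 + l) :=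
    Finset.prod_congr rfl fun j _ => by ring
  have h2 : ∏ j ∈ range (n + 1), (t + 1 / 2 + (j : ℚ)) = (∏ j ∈ range (n + 1), (2 * t + 2 * j + 1)) / 2 ^ (n + 1) :=
    prod_add_half n t
  rw [h1, h2, div_pow, ← pow_mul]
  have h3 : (2 : ℚ) ^ ((n + 1) * 4) = 2 ^ (4 * n + 4) := by ring_nf
  rw [h3]
  by_cases hQ : (∏ j ∈ range (n + 1), (2 * t + 2 * (j : ℚ) + 1)) = 0
  · rw [hQ]; simp
  · have h2' : (2 : ℚ) ^ (4 * n + 4) ≠ 0 := by positivity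
    field_simp
    ring

/-- Near a natural number `m` (indeed on `t > −½`) none of the factors `2t+2j+1` vanishes. [cite: LaiSprangZudilin2026, Lemma 6.2 (proof)] -/
theorem two_mul_add_ne_zero_of_gt {t : ℚ} (ht : -(1 / 2 : ℚ) < t) (j : ℕ) : 2 * t + 2 * j + 1 ≠ 0 := by
  have : (0 : ℚ) ≤ j := Nat.cast_nonneg j
  intro h; linarith

/-- **The Leibniz rule for `R_n(t+½)`**: the derivative of `Rhalf n` at a point `x` with `2x+2j+1 ≠ 0` is
`2^{12n+4}·[2·P⁴·(Q⁴)^{−1} + (2x+n+1)·(4P³P′)·(Q⁴)^{−1} + (2x+n+1)·P⁴·(−(4Q³Q′)/(Q⁴)²)]` with `P = ∏_{l<n}(x+1+l)`,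
`P′ = Σ_l ∏_{i≠l}(x+1+i)`, `Q = ∏_{j≤n}(2x+2j+1)`, `Q′ = Σ_j (∏_{i≠j}(2x+2i+1))·2`.
[cite: LaiSprangZudilin2026, Lemma 6.2 (proof, "By the Leibniz rule we deduce")] -/
theorem hasDerivAt_Rhalf (n : ℕ) {x : ℚ} (hx : ∀ j ∈ range (n + 1), 2 * x + 2 * j + 1 ≠ 0) :
    HasDerivAt (Rhalf n)
      (2 ^ (12 * n + 4) * (2 * ((∏ l ∈ range n, (x + 1 + l)) ^ 4 * ((∏ j ∈ range (n + 1), (2 * x + 2 * j + 1)) ^ 4)⁻¹) +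
        (2 * x + n + 1) * ((4 * (∏ l ∈ range n, (x + 1 + l)) ^ 3 *
            (∑ l ∈ range n, (∏ i ∈ (range n).erase l, (x + 1 + i)) * 1)) *
              ((∏ j ∈ range (n + 1), (2 * x + 2 * j + 1)) ^ 4)⁻¹ +
          (∏ l ∈ range n, (x + 1 + l)) ^ 4 *
            (-(4 * (∏ j ∈ range (n + 1), (2 * x + 2 * j + 1)) ^ 3 *
                (∑ j ∈ range (n + 1), (∏ i ∈ (range (n + 1)).erase j, (2 * x + 2 * i + 1)) * 2)) /
              ((∏ j ∈ range (n + 1), (2 * x + 2 * j + 1)) ^ 4) ^ 2)))) x := by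
  -- the three factors
  have hlin : HasDerivAt (fun t : ℚ => 2 * t + n + 1) 2 x := by
    have := ((hasDerivAt_id x).const_mul (2 : ℚ)).add_const ((n : ℚ) + 1)
    simpa [mul_one, add_assoc] using this
  have hP : HasDerivAt (fun t : ℚ => ∏ l ∈ range n, (t + 1 + l))
      (∑ l ∈ range n, (∏ i ∈ (range n).erase l, (x + 1 + i)) * 1) x := by
    have h := HasDerivAt.finsetProd (u := range n) (f := fun (l : ℕ) (t : ℚ) => t + 1 + l) (f' := fun _ => 1)
      (x := x) fun l _ => by
        have := (hasDerivAt_id x).add_const (1 + (l : ℚ))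
        simpa [add_assoc] using this
    rw [Finset.prod_fn] at h
    simpa [smul_eq_mul] using h
  have hQ : HasDerivAt (fun t : ℚ => ∏ j ∈ range (n + 1), (2 * t + 2 * j + 1))
      (∑ j ∈ range (n + 1), (∏ i ∈ (range (n + 1)).erase j, (2 * x + 2 * i + 1)) * 2) x := by
    have h := HasDerivAt.finsetProd (u := range (n + 1)) (f := fun (j : ℕ) (t : ℚ) => 2 * t + 2 * j + 1) (f' := fun _ => 2)
      (x := x) fun j _ => by
        have := ((hasDerivAt_id x).const_mul (2 : ℚ)).add_const (2 * (j : ℚ) + 1)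
        simpa [mul_one, add_assoc] using this
    rw [Finset.prod_fn] at h
    simpa [smul_eq_mul] using h
  have hQ0 : (∏ j ∈ range (n + 1), (2 * x + 2 * (j : ℚ) + 1)) ^ 4 ≠ 0 := pow_ne_zero _ (prod_ne_zero_iff.2 hx)
  have hP4 := hP.pow 4
  have hQ4inv := (hQ.pow 4).inv hQ0
  rw [show (4 : ℕ) - 1 = 3 from rfl] at hP4 hQ4inv
  have h := ((hlin.mul hP4).mul hQ4inv).const_mul ((2 : ℚ) ^ (12 * n + 4))
  have hpt : ∀ t : ℚ, Rhalf n t = 2 ^ (12 * n + 4) *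
      ((fun t : ℚ => 2 * t + n + 1) * (fun t : ℚ => ∏ l ∈ range n, (t + 1 + l)) ^ 4 *
        ((fun t : ℚ => ∏ j ∈ range (n + 1), (2 * t + 2 * j + 1)) ^ 4)⁻¹) t := by
    intro t
    simp only [Rhalf, Pi.mul_apply, Pi.pow_apply, Pi.inv_apply]
    ring
  have h' : HasDerivAt (Rhalf n) _ x := h.congr_of_eventuallyEq (Eventually.of_forall hpt)
  refine h'.congr_deriv ?_
  simp only [Pi.pow_apply, Pi.inv_apply, Pi.mul_apply, Nat.cast_ofNat]
  ring

/-! ### The derivative at a natural number `m`, and the binomial bookkeeping -/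

/-- `u_j(m) = (2m+2j+1)^{−1}` (over `ℚ`). [cite: LaiSprangZudilin2026, Lemma 6.2 (proof, the function `g(t)`)] -/
def uq (j m : ℕ) : ℚ := (((2 * m + 2 * j + 1 : ℕ) : ℚ))⁻¹

/-- `W(m) = ∏_{j≤n} u_j(m) = 1/∏_{j≤n}(2m+2j+1)` (so `g(m) = (2m+n+1)·W(m)⁴`). [cite: LaiSprangZudilin2026, Lemma 6.2 (proof, the function `g(t)`)] -/
def Wq (n m : ℕ) : ℚ := ∏ j ∈ range (n + 1), uq j m

/-- `e_l(m) = l!(n−1−l)!·binom(m+l,l)·binom(m+n,n−1−l) = ∏_{i<n, i≠l}(m+1+i)` (the term `(j−1)!(n−j)!binom(t+j−1,j−1)binom(t+n,n−j)`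
of the print, `j = l+1`). [cite: LaiSprangZudilin2026, Lemma 6.2 (proof, second display)] -/
def eq_ (n l m : ℕ) : ℚ := ((l ! * (n - 1 - l)! * (m + l).choose l * (m + n).choose (n - 1 - l) : ℕ) : ℚ)

/-- `∏_{i<n}(m+1+i) = n!·binom(m+n,n)`. [cite: LaiSprangZudilin2026, Lemma 6.2 (proof, "`∏_{j=1}^{n}(t+j)⁴ = n!⁴binom(t+n,n)⁴`")] -/
theorem prod_range_add_eq_factorial_mul_choose (n m : ℕ) :
    ∏ i ∈ range n, ((m : ℚ) + 1 + i) = ((n ! * (m + n).choose n : ℕ) : ℚ) := by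
  rw [← Nat.ascFactorial_eq_factorial_mul_choose, Nat.ascFactorial_eq_prod_range]
  push_cast
  exact prod_congr rfl fun i _ => by ring

/-- The product with one factor removed: `∏_{i<n, i≠l}(m+1+i) = e_l(m)` for `l < n`.
[cite: LaiSprangZudilin2026, Lemma 6.2 (proof, second display)] -/
theorem prod_erase_eq (n : ℕ) {l : ℕ} (hl : l < n) (m : ℕ) :
    ∏ i ∈ (range n).erase l, ((m : ℚ) + 1 + i) = eq_ n l m := by
  -- split `range n = range l ∪ {l} ∪ Ico (l+1) n`
  have hsplit : ∏ i ∈ range n, ((m : ℚ) + 1 + i) =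
      (∏ i ∈ range l, ((m : ℚ) + 1 + i)) * (((m : ℚ) + 1 + l) * ∏ i ∈ Ico (l + 1) n, ((m : ℚ) + 1 + i)) := by
    rw [← Finset.prod_range_mul_prod_Ico _ hl.le, Finset.prod_eq_prod_Ico_succ_bot hl]
  have hne : ((m : ℚ) + 1 + l) ≠ 0 := by positivity
  have herase : ((m : ℚ) + 1 + l) * ∏ i ∈ (range n).erase l, ((m : ℚ) + 1 + i) = ∏ i ∈ range n, ((m : ℚ) + 1 + i) :=
    Finset.mul_prod_erase (range n) (fun i => (m : ℚ) + 1 + i) (mem_range.2 hl)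
  have h1 : ∏ i ∈ range l, ((m : ℚ) + 1 + i) = ((l ! * (m + l).choose l : ℕ) : ℚ) :=
    prod_range_add_eq_factorial_mul_choose l m
  have h2 : ∏ i ∈ Ico (l + 1) n, ((m : ℚ) + 1 + i) = (((n - 1 - l)! * (m + n).choose (n - 1 - l) : ℕ) : ℚ) := by
    rw [Finset.prod_Ico_eq_prod_range, show n - 1 - l = n - (l + 1) by omega]
    have h := prod_range_add_eq_factorial_mul_choose (n - (l + 1)) (m + l + 1)
    rw [show m + l + 1 + (n - (l + 1)) = m + n by omega] at h
    rw [← h]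
    refine prod_congr rfl fun i _ => ?_
    push_cast; ring
  have key : ((m : ℚ) + 1 + l) * ∏ i ∈ (range n).erase l, ((m : ℚ) + 1 + i) = ((m : ℚ) + 1 + l) * eq_ n l m := by
    rw [herase, hsplit, h1, h2, eq_]
    push_cast; ring
  exact mul_left_cancel₀ hne key

/-- The logarithmic derivative of `Q = ∏_{j≤n}(2m+2j+1)`: `Q′ = Q·Σ_j 2u_j(m)`. [cite: LaiSprangZudilin2026, Lemma 6.2 (proof, the function `g′(t)`)] -/
theorem sum_prod_erase_eq (n m : ℕ) :
    ∑ j ∈ range (n + 1), (∏ i ∈ (range (n + 1)).erase j, (2 * (m : ℚ) + 2 * i + 1)) * 2 =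
      (∏ j ∈ range (n + 1), (2 * (m : ℚ) + 2 * j + 1)) * (2 * ∑ j ∈ range (n + 1), uq j m) := by
  rw [← mul_assoc, mul_sum]
  refine sum_congr rfl fun j hj => ?_
  have hq : (2 * (m : ℚ) + 2 * j + 1) ≠ 0 := by positivity
  have h := Finset.mul_prod_erase (range (n + 1)) (fun i => (2 * (m : ℚ) + 2 * (i : ℚ) + 1)) hj
  rw [uq]
  push_cast
  rw [← h]
  field_simp

/-- **The Leibniz form of the integrand at a natural number** (LSZ's second display, with `g′` expanded):
`D_n(m) = −R_n′(m+½) = −2^{12n+4}·W⁴·(2n!⁴C⁴ + 4(2m+n+1)n!³C³Σ_{l<n}e_l − 8(2m+n+1)n!⁴C⁴Σ_{j≤n}u_j)`,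
`C = binom(m+n,n)`, `W = ∏_{j≤n}u_j`, `u_j = (2m+2j+1)^{−1}`. [cite: LaiSprangZudilin2026, Lemma 6.2 (proof, second display)] -/
theorem Dq_natCast_eq_leibniz (n m : ℕ) :
    Dq n m = -(2 ^ (12 * n + 4) * Wq n m ^ 4 *
      (2 * ((n ! : ℕ) : ℚ) ^ 4 * (((m + n).choose n : ℕ) : ℚ) ^ 4 +
        4 * (2 * (m : ℚ) + n + 1) * ((n ! : ℕ) : ℚ) ^ 3 * (((m + n).choose n : ℕ) : ℚ) ^ 3 * ∑ l ∈ range n, eq_ n l m -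
        8 * (2 * (m : ℚ) + n + 1) * ((n ! : ℕ) : ℚ) ^ 4 * (((m + n).choose n : ℕ) : ℚ) ^ 4 * ∑ j ∈ range (n + 1), uq j m)) := by
  have hx : ∀ j ∈ range (n + 1), 2 * (m : ℚ) + 2 * j + 1 ≠ 0 := fun j _ => by positivity
  -- the two derivatives of `t ↦ R_n(t+½)` at `t = m`
  have hpf : HasDerivAt (fun t : ℚ => R n (t + 1 / 2)) (-Dq n m) (m : ℚ) := by
    have h := hasDerivAt_R_half n (x := (m : ℚ)) fun j _ => by positivity
    exact h.comp_add_const (m : ℚ) (1 / 2)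
  have hprod := hasDerivAt_Rhalf n hx
  have hgerm : (fun t : ℚ => R n (t + 1 / 2)) =ᶠ[𝓝 (m : ℚ)] Rhalf n := by
    have hmem : Set.Ioi (-(1 / 2 : ℚ)) ∈ 𝓝 (m : ℚ) := Ioi_mem_nhds (by have := Nat.cast_nonneg (α := ℚ) m; linarith)
    filter_upwards [hmem] with t ht
    exact R_add_half_eq n t
  have hprod' := hprod.congr_of_eventuallyEq hgerm
  have huniq := hpf.unique hprod'
  -- rewrite the Leibniz expression
  have hP := prod_range_add_eq_factorial_mul_choose n m
  have hE : ∑ l ∈ range n, (∏ i ∈ (range n).erase l, ((m : ℚ) + 1 + i)) * 1 = ∑ l ∈ range n, eq_ n l m :=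
    sum_congr rfl fun l hl => by rw [mul_one, prod_erase_eq n (mem_range.1 hl) m]
  have hQ' := sum_prod_erase_eq n m
  set Q : ℚ := ∏ j ∈ range (n + 1), (2 * (m : ℚ) + 2 * j + 1) with hQdef
  have hQ0 : Q ≠ 0 := prod_ne_zero_iff.2 hx
  have hW : Wq n m = Q⁻¹ := by
    rw [Wq, hQdef, ← Finset.prod_inv_distrib]
    refine prod_congr rfl fun j _ => ?_
    rw [uq]; push_cast; ring
  have e := huniq
  rw [hE, hQ', hP] at e
  have e2 := neg_eq_iff_eq_neg.mp e
  rw [e2, neg_inj, hW]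
  push_cast
  field_simp
  ring

/-! ## §2. The 2-adic valuations: `n!`, and the norms of the scalar factors -/

/-- `v₂`-bookkeeping of a natural number: `‖N‖₂ = 2^{−v₂(N)}` for `N ≠ 0`. [cite: LaiSprangZudilin2026, Lemma 6.2 (proof, "Now notice that `v₂(n!) ≥ …`")] -/
theorem norm_natCast_eq_two_zpow {N : ℕ} (hN : N ≠ 0) :
    ‖(N : ℚ_[2])‖ = (2 : ℝ) ^ (-(padicValNat 2 N : ℤ)) := by
  have h := Padic.eq_padicNorm (p := 2) (N : ℚ)
  rw [Rat.cast_natCast] at h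
  rw [h, padicNorm.eq_zpow_of_nonzero (by exact_mod_cast hN), padicValRat.of_nat]
  push_cast
  rfl

/-- **`v₂(n!) ≥ n − ⌊log₂ n⌋ − 1`** ("`v₂(n!) ≥ n − log(n+1)/log 2`"; Legendre: `v₂(n!) = n − s₂(n)` and the binary digit sum
is at most the number of binary digits `⌊log₂ n⌋ + 1`). [cite: LaiSprangZudilin2026, Lemma 6.2 (proof, "`v₂(n!) ≥ n − log(n+1)/log 2`")] -/
theorem sub_log_le_padicValNat_factorial (n : ℕ) : (n : ℤ) - (Nat.log 2 n + 1 : ℕ) ≤ padicValNat 2 (n !) := by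
  have h := sub_one_mul_padicValNat_factorial (p := 2) n
  norm_num at h
  -- digit sum ≤ number of digits
  have hsum : (Nat.digits 2 n).sum ≤ Nat.log 2 n + 1 := by
    rcases Nat.eq_zero_or_pos n with rfl | hn
    · simp
    · have hlen : (Nat.digits 2 n).length = Nat.log 2 n + 1 := Nat.length_digits 2 n (by norm_num) hn.ne'
      have hle : (Nat.digits 2 n).sum ≤ (Nat.digits 2 n).length • 1 :=
        List.sum_le_card_nsmul _ 1 fun d hd => Nat.le_of_lt_succ (Nat.digits_lt_base (by norm_num) hd)
      simpa [hlen] using hle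
  have hds : (Nat.digits 2 n).sum ≤ n := Nat.digit_sum_le 2 n
  omega

/-- `‖n!‖₂ ≤ 2^{⌊log₂ n⌋ + 1 − n}`. [cite: LaiSprangZudilin2026, Lemma 6.2 (proof, "`v₂(n!) ≥ n − log(n+1)/log 2`")] -/
theorem norm_factorial_le (n : ℕ) : ‖((n ! : ℕ) : ℚ_[2])‖ ≤ (2 : ℝ) ^ ((Nat.log 2 n + 1 : ℕ) - (n : ℤ)) := by
  rw [norm_natCast_eq_two_zpow (Nat.factorial_ne_zero n)]
  refine zpow_le_zpow_right₀ (by norm_num) ?_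
  have := sub_log_le_padicValNat_factorial n
  omega

/-- Monotonicity of the binomial Lipschitz constants: `2^{⌊log₂ r⌋} ≤ 2^{⌊log₂ n⌋}` for `r ≤ n`. [cite: LaiSprangZudilin2026, Lemma 6.2 (proof, part (e) bounds)] -/
theorem two_pow_log_mono {r n : ℕ} (h : r ≤ n) : (2 : ℝ) ^ Nat.log 2 r ≤ (2 : ℝ) ^ Nat.log 2 n :=
  pow_le_pow_right₀ (by norm_num) (Nat.log_mono_right h)

/-! ## §3. Lemma 6.2: the Lipschitz constant and the value at `0` of `D_n`, hence `‖S_n‖₂ ≤ 2^{6L+1−16n}` -/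

section Brackets

/-- `u_j(m) = (2m + (2j+1))^{−1}` in `ℚ₂` (a unit: `2j+1` is odd). [cite: LaiSprangZudilin2026, Lemma 6.2 (proof, the function `g(t)`)] -/
def u2 (j m : ℕ) : ℚ_[2] := ((2 : ℚ_[2]) * m + ((2 * j + 1 : ℕ) : ℚ_[2]))⁻¹

/-- `W(m) = ∏_{j≤n} u_j(m)` in `ℚ₂`. [cite: LaiSprangZudilin2026, Lemma 6.2 (proof, the function `g(t)`)] -/
def W2 (n m : ℕ) : ℚ_[2] := ∏ j ∈ range (n + 1), u2 j m

/-- The binomial polynomial `binom(m+c, r)` in `ℚ₂`. [cite: LaiSprangZudilin2026, Lemma 6.2 (proof, part (e))] -/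
def C2 (c r m : ℕ) : ℚ_[2] := (((m + c).choose r : ℕ) : ℚ_[2])

/-- The linear factor `2m + n + 1` in `ℚ₂`. [cite: LaiSprangZudilin2026, Lemma 6.2 (proof, the function `g(t)`)] -/
def lin2 (n m : ℕ) : ℚ_[2] := (2 : ℚ_[2]) * m + ((n + 1 : ℕ) : ℚ_[2])

/-- The three scalar factors `2^{12n+5}n!⁴`, `2^{12n+6}n!³l!(n−1−l)!`, `2^{12n+7}n!⁴` of the Leibniz form.
[cite: LaiSprangZudilin2026, Lemma 6.2 (proof, second display)] -/
def cst₁ (n : ℕ) : ℚ_[2] := (2 : ℚ_[2]) ^ (12 * n + 5) * ((n ! : ℕ) : ℚ_[2]) ^ 4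

/-- See `cst₁`. [cite: LaiSprangZudilin2026, Lemma 6.2 (proof, second display)] -/
def cst₂ (n l : ℕ) : ℚ_[2] :=
  (2 : ℚ_[2]) ^ (12 * n + 6) * ((n ! : ℕ) : ℚ_[2]) ^ 3 * ((l ! : ℕ) : ℚ_[2]) * (((n - 1 - l)! : ℕ) : ℚ_[2])

/-- See `cst₁`. [cite: LaiSprangZudilin2026, Lemma 6.2 (proof, second display)] -/
def cst₃ (n : ℕ) : ℚ_[2] := (2 : ℚ_[2]) ^ (12 * n + 7) * ((n ! : ℕ) : ℚ_[2]) ^ 4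

/-- **The Leibniz form of `−D_n` as a function on `ℕ` with values in `ℚ₂`**, grouped as
`cst₁·[W⁴C⁴] + Σ_{l<n} cst₂(l)·[(2m+n+1)W⁴C³binom(m+l,l)binom(m+n,n−1−l)] − Σ_{j≤n} cst₃·[(2m+n+1)W⁴C⁴u_j]` (`C = binom(m+n,n)`).
[cite: LaiSprangZudilin2026, Lemma 6.2 (proof, second display)] -/
def G2 (n m : ℕ) : ℚ_[2] :=
  cst₁ n * (W2 n m ^ 4 * C2 n n m ^ 4) +
    (∑ l ∈ range n, cst₂ n l * (lin2 n m * W2 n m ^ 4 * C2 n n m ^ 3 * C2 l l m * C2 n (n - 1 - l) m)) -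
    ∑ j ∈ range (n + 1), cst₃ n * (lin2 n m * W2 n m ^ 4 * C2 n n m ^ 4 * u2 j m)

/-- `D_n(m) = −G2 n m` at every natural number `m` (the cast of `Dq_natCast_eq_leibniz` into `ℚ₂`).
[cite: LaiSprangZudilin2026, Lemma 6.2 (proof, second display)] -/
theorem D_natCast_eq_neg_G2 (n m : ℕ) : D n (m : ℤ_[2]) = -G2 n m := by
  have hW : ((Wq n m : ℚ) : ℚ_[2]) = W2 n m := by
    simp only [Wq, uq, W2, u2]
    push_cast
    refine prod_congr rfl fun j _ => ?_
    ring
  have hSe : ∑ l ∈ range n, cst₂ n l * (lin2 n m * W2 n m ^ 4 * C2 n n m ^ 3 * C2 l l m * C2 n (n - 1 - l) m) =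
      (2 : ℚ_[2]) ^ (12 * n + 6) * ((n ! : ℕ) : ℚ_[2]) ^ 3 * lin2 n m * W2 n m ^ 4 * C2 n n m ^ 3 *
        ∑ l ∈ range n, ((eq_ n l m : ℚ) : ℚ_[2]) := by
    rw [Finset.mul_sum]
    refine sum_congr rfl fun l _ => ?_
    simp only [cst₂, eq_, C2]
    push_cast
    ring
  have hSu : ∑ j ∈ range (n + 1), cst₃ n * (lin2 n m * W2 n m ^ 4 * C2 n n m ^ 4 * u2 j m) =
      (2 : ℚ_[2]) ^ (12 * n + 7) * ((n ! : ℕ) : ℚ_[2]) ^ 4 * lin2 n m * W2 n m ^ 4 * C2 n n m ^ 4 *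
        ∑ j ∈ range (n + 1), ((uq j m : ℚ) : ℚ_[2]) := by
    rw [Finset.mul_sum]
    refine sum_congr rfl fun j _ => ?_
    simp only [cst₃, u2, uq]
    push_cast
    ring
  rw [D_natCast, Dq_natCast_eq_leibniz, G2, hSe, hSu]
  push_cast
  rw [hW]
  simp only [cst₁, C2, lin2]
  push_cast
  ring

/-- `‖2‖₂ = ½` (plumbing). [folklore] -/
private theorem norm_two_eq : ‖(2 : ℚ_[2])‖ = 2⁻¹ := by simpa using Padic.norm_p (p := 2)

/-- The unit denominators: `u_j` is `ℤ₂`-valued and Lipschitz with constant `½`.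
[cite: LaiSprangZudilin2026, Lemma 6.2 (proof, "`Δ(g) ≥ 0` and `Δ(g′) ≥ 0`")] -/
theorem lipNat_u2 (j : ℕ) : LipNat 2 2⁻¹ (u2 j) ∧ BddNat 2 (u2 j) := by
  have ha : ‖(2 : ℚ_[2])‖ < 1 := by rw [norm_two_eq]; norm_num
  have hb : ‖((2 * j + 1 : ℕ) : ℚ_[2])‖ = 1 := norm_natCast_of_not_dvd (p := 2) (by omega)
  refine ⟨?_, ?_⟩
  · have h := lipNat_inv_linear (p := 2) ha hb
    rw [norm_two_eq] at h
    exact h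
  · exact bddNat_inv_linear (p := 2) ha hb

/-- The linear factor `2m+n+1` is `ℤ₂`-valued and Lipschitz with constant `½`. [cite: LaiSprangZudilin2026, Lemma 6.2 (proof, "`Δ(g) ≥ 0`")] -/
theorem lipNat_lin2 (n : ℕ) : LipNat 2 2⁻¹ (lin2 n) ∧ BddNat 2 (lin2 n) := by
  refine ⟨?_, ?_⟩
  · have h := lipNat_linear (p := 2) (2 : ℚ_[2]) ((n + 1 : ℕ) : ℚ_[2])
    rw [norm_two_eq] at h
    exact h
  · refine bddNat_linear (p := 2) (by rw [norm_two_eq]; norm_num) ?_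
    have h := Padic.norm_int_le_one (p := 2) ((n + 1 : ℕ) : ℤ)
    rwa [Int.cast_natCast] at h

/-- The binomial factor `binom(m+c,r)`, `r ≤ n`: `ℤ₂`-valued, Lipschitz with constant `2^{⌊log₂ n⌋}`.
[cite: LaiSprangZudilin2026, Lemma 6.2 (proof, part (e): "`≥ −⌊log n/log 2⌋`")] -/
theorem lipNat_C2 {n r : ℕ} (hr : r ≤ n) (c : ℕ) :
    LipNat 2 ((2 : ℝ) ^ Nat.log 2 n) (C2 c r) ∧ BddNat 2 (C2 c r) := by
  refine ⟨?_, ?_⟩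
  · exact (lipNat_choose (p := 2) c r).mono (two_pow_log_mono hr)
  · exact BddNat.natCast (p := 2) fun m => (m + c).choose r

variable (n : ℕ)

/-- `W⁴` is `ℤ₂`-valued and Lipschitz with constant `2^L` (`L = ⌊log₂ n⌋`; indeed `½`).
[cite: LaiSprangZudilin2026, Lemma 6.2 (proof, part (c))] -/
theorem lipNat_W2_pow : LipNat 2 ((2 : ℝ) ^ Nat.log 2 n) (fun m => W2 n m ^ 4) ∧ BddNat 2 (fun m => W2 n m ^ 4) := by
  have hK : (2 : ℝ)⁻¹ ≤ (2 : ℝ) ^ Nat.log 2 n := le_trans (by norm_num) (one_le_pow₀ (by norm_num))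
  have hW : LipNat 2 ((2 : ℝ) ^ Nat.log 2 n) (W2 n) ∧ BddNat 2 (W2 n) := by
    refine ⟨?_, ?_⟩
    · exact LipNat.finset_prod (p := 2) (range (n + 1)) (F := fun j m => u2 j m) (by positivity)
        (fun j _ => ((lipNat_u2 j).1).mono hK) (fun j _ => (lipNat_u2 j).2)
    · exact BddNat.finset_prod (p := 2) (range (n + 1)) (F := fun j m => u2 j m) (fun j _ => (lipNat_u2 j).2)
  exact ⟨hW.1.pow hW.2 (by positivity) 4, hW.2.pow 4⟩

/-- The first bracket `W⁴C⁴`. [cite: LaiSprangZudilin2026, Lemma 6.2 (proof, parts (c)–(e))] -/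
theorem lipNat_bracket₁ : LipNat 2 ((2 : ℝ) ^ Nat.log 2 n) (fun m => W2 n m ^ 4 * C2 n n m ^ 4) ∧
    BddNat 2 (fun m => W2 n m ^ 4 * C2 n n m ^ 4) := by
  have hW := lipNat_W2_pow n
  have hC := lipNat_C2 (le_refl n) n
  have hC4 : LipNat 2 ((2 : ℝ) ^ Nat.log 2 n) (fun m => C2 n n m ^ 4) ∧ BddNat 2 (fun m => C2 n n m ^ 4) :=
    ⟨hC.1.pow hC.2 (by positivity) 4, hC.2.pow 4⟩
  exact ⟨hW.1.mul' hC4.1 hW.2 hC4.2, hW.2.mul hC4.2⟩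

/-- The second bracket `(2m+n+1)W⁴C³binom(m+l,l)binom(m+n,n−1−l)`, `l < n`. [cite: LaiSprangZudilin2026, Lemma 6.2 (proof, parts (c)–(e))] -/
theorem lipNat_bracket₂ {l : ℕ} (hl : l < n) :
    LipNat 2 ((2 : ℝ) ^ Nat.log 2 n) (fun m => lin2 n m * W2 n m ^ 4 * C2 n n m ^ 3 * C2 l l m * C2 n (n - 1 - l) m) ∧
    BddNat 2 (fun m => lin2 n m * W2 n m ^ 4 * C2 n n m ^ 3 * C2 l l m * C2 n (n - 1 - l) m) := by
  have hK : (2 : ℝ)⁻¹ ≤ (2 : ℝ) ^ Nat.log 2 n := le_trans (by norm_num) (one_le_pow₀ (by norm_num))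
  have hL : LipNat 2 ((2 : ℝ) ^ Nat.log 2 n) (lin2 n) ∧ BddNat 2 (lin2 n) := ⟨(lipNat_lin2 n).1.mono hK, (lipNat_lin2 n).2⟩
  have hW := lipNat_W2_pow n
  have hC := lipNat_C2 (le_refl n) n
  have hC3 : LipNat 2 ((2 : ℝ) ^ Nat.log 2 n) (fun m => C2 n n m ^ 3) ∧ BddNat 2 (fun m => C2 n n m ^ 3) :=
    ⟨hC.1.pow hC.2 (by positivity) 3, hC.2.pow 3⟩
  have hCl := lipNat_C2 (n := n) (r := l) hl.le l
  have hCn := lipNat_C2 (n := n) (r := n - 1 - l) (by omega) n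
  have h1 := And.intro (hL.1.mul' hW.1 hL.2 hW.2) (hL.2.mul hW.2)
  have h2 := And.intro (h1.1.mul' hC3.1 h1.2 hC3.2) (h1.2.mul hC3.2)
  have h3 := And.intro (h2.1.mul' hCl.1 h2.2 hCl.2) (h2.2.mul hCl.2)
  exact ⟨h3.1.mul' hCn.1 h3.2 hCn.2, h3.2.mul hCn.2⟩

/-- The third bracket `(2m+n+1)W⁴C⁴u_j`. [cite: LaiSprangZudilin2026, Lemma 6.2 (proof, parts (c)–(e))] -/
theorem lipNat_bracket₃ (j : ℕ) :
    LipNat 2 ((2 : ℝ) ^ Nat.log 2 n) (fun m => lin2 n m * W2 n m ^ 4 * C2 n n m ^ 4 * u2 j m) ∧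
    BddNat 2 (fun m => lin2 n m * W2 n m ^ 4 * C2 n n m ^ 4 * u2 j m) := by
  have hK : (2 : ℝ)⁻¹ ≤ (2 : ℝ) ^ Nat.log 2 n := le_trans (by norm_num) (one_le_pow₀ (by norm_num))
  have hL : LipNat 2 ((2 : ℝ) ^ Nat.log 2 n) (lin2 n) ∧ BddNat 2 (lin2 n) := ⟨(lipNat_lin2 n).1.mono hK, (lipNat_lin2 n).2⟩
  have hB := lipNat_bracket₁ n
  have hu : LipNat 2 ((2 : ℝ) ^ Nat.log 2 n) (u2 j) ∧ BddNat 2 (u2 j) := ⟨(lipNat_u2 j).1.mono hK, (lipNat_u2 j).2⟩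
  have h1 : LipNat 2 ((2 : ℝ) ^ Nat.log 2 n) (fun m => lin2 n m * (W2 n m ^ 4 * C2 n n m ^ 4)) ∧
      BddNat 2 (fun m => lin2 n m * (W2 n m ^ 4 * C2 n n m ^ 4)) := ⟨hL.1.mul' hB.1 hL.2 hB.2, hL.2.mul hB.2⟩
  have h2 := And.intro (h1.1.mul' hu.1 h1.2 hu.2) (h1.2.mul hu.2)
  refine ⟨?_, ?_⟩
  · intro k h; have := h2.1 k h; simp only [mul_assoc] at this ⊢; exact this
  · intro k; have := h2.2 k; simp only [mul_assoc] at this ⊢; exact this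

end Brackets

/-! ### The norms of the scalar factors -/

/-- `v₂(l!) ≥ l − ⌊log₂ n⌋ − 1` for `l ≤ n`. [cite: LaiSprangZudilin2026, Lemma 6.2 (proof, "`v₂((j−1)!(n−j)!) ≥ …`")] -/
theorem sub_log_le_padicValNat_factorial_of_le {l n : ℕ} (h : l ≤ n) :
    (l : ℤ) - (Nat.log 2 n + 1 : ℕ) ≤ padicValNat 2 (l !) := by
  have h1 := sub_log_le_padicValNat_factorial l
  have h2 : Nat.log 2 l ≤ Nat.log 2 n := Nat.log_mono_right h
  push_cast at h1 ⊢
  linarith [(by exact_mod_cast h2 : (Nat.log 2 l : ℤ) ≤ Nat.log 2 n)]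

/-- `‖N‖₂` for `N = n!` as an exact power of `2`. [cite: LaiSprangZudilin2026, Lemma 6.2 (proof)] -/
theorem norm_factorial_eq (k : ℕ) : ‖((k ! : ℕ) : ℚ_[2])‖ = (2 : ℝ) ^ (-(padicValNat 2 (k !) : ℤ)) :=
  norm_natCast_eq_two_zpow (Nat.factorial_ne_zero k)

/-- `‖2^a‖₂ = 2^{−a}`. [cite: LaiSprangZudilin2026, Lemma 6.2 (proof)] -/
theorem norm_two_pow (a : ℕ) : ‖(2 : ℚ_[2]) ^ a‖ = (2 : ℝ) ^ (-(a : ℤ)) := by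
  rw [norm_pow, norm_two_eq, zpow_neg, zpow_natCast, inv_pow]

/-- **`‖cst₁‖₂ ≤ 2^{5L−16n}`** (`= 2^{−(12n+5)−4v₂(n!)}`, `v₂(n!) ≥ n−L−1`). [cite: LaiSprangZudilin2026, Lemma 6.2 (proof, "by parts (a), (b)")] -/
theorem norm_cst₁_le (n : ℕ) : ‖cst₁ n‖ ≤ (2 : ℝ) ^ (5 * (Nat.log 2 n : ℤ) - 16 * n) := by
  rw [cst₁, norm_mul, norm_pow ((n ! : ℕ) : ℚ_[2]), norm_two_pow, norm_factorial_eq, ← zpow_natCast, ← zpow_mul,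
    ← zpow_add₀ (by norm_num : (2 : ℝ) ≠ 0)]
  refine zpow_le_zpow_right₀ (by norm_num) ?_
  have h := sub_log_le_padicValNat_factorial n
  push_cast at h ⊢
  linarith

/-- **`‖cst₃‖₂ ≤ 2^{5L−16n}`**. [cite: LaiSprangZudilin2026, Lemma 6.2 (proof, "by parts (a), (b)")] -/
theorem norm_cst₃_le (n : ℕ) : ‖cst₃ n‖ ≤ (2 : ℝ) ^ (5 * (Nat.log 2 n : ℤ) - 16 * n) := by
  rw [cst₃, norm_mul, norm_pow ((n ! : ℕ) : ℚ_[2]), norm_two_pow, norm_factorial_eq, ← zpow_natCast, ← zpow_mul,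
    ← zpow_add₀ (by norm_num : (2 : ℝ) ≠ 0)]
  refine zpow_le_zpow_right₀ (by norm_num) ?_
  have h := sub_log_le_padicValNat_factorial n
  push_cast at h ⊢
  linarith

/-- **`‖cst₂(l)‖₂ ≤ 2^{5L−16n}`** for `l < n` (`v₂(n!³l!(n−1−l)!) ≥ 4n − 5L − 6`). [cite: LaiSprangZudilin2026, Lemma 6.2 (proof, "`v₂((j−1)!(n−j)!) ≥ n − 1 − …`")] -/
theorem norm_cst₂_le (n : ℕ) {l : ℕ} (hl : l < n) : ‖cst₂ n l‖ ≤ (2 : ℝ) ^ (5 * (Nat.log 2 n : ℤ) - 16 * n) := by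
  rw [cst₂, norm_mul, norm_mul, norm_mul, norm_pow ((n ! : ℕ) : ℚ_[2]), norm_two_pow, norm_factorial_eq,
    norm_factorial_eq, norm_factorial_eq, ← zpow_natCast, ← zpow_mul,
    ← zpow_add₀ (by norm_num : (2 : ℝ) ≠ 0), ← zpow_add₀ (by norm_num : (2 : ℝ) ≠ 0),
    ← zpow_add₀ (by norm_num : (2 : ℝ) ≠ 0)]
  refine zpow_le_zpow_right₀ (by norm_num) ?_
  have h1 := sub_log_le_padicValNat_factorial n
  have h2 := sub_log_le_padicValNat_factorial_of_le hl.le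
  have h3 := sub_log_le_padicValNat_factorial_of_le (show n - 1 - l ≤ n by omega)
  have h4 : ((n - 1 - l : ℕ) : ℤ) = n - 1 - l := by omega
  push_cast at h1 h2 h3 ⊢
  rw [h4] at h3
  linarith

/-! ### Lemma 6.2 -/

/-- **`Δ(R_n′(t+½)) ≥ 16n − 5L` in Lipschitz form**: `‖G2 n (k+h) − G2 n k‖₂ ≤ 2^{6L−16n}‖h‖₂` and `‖G2 n 0‖₂ ≤ 2^{5L−16n}`
(parts (a)–(c) of Lemma 2.6 applied to the Leibniz form). [cite: LaiSprangZudilin2026, Lemma 6.2 (proof, "`Δ(R_n′(t+½)) ≥ 16n + 4 − 6log(n+1)/log 2`")] -/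
theorem lipNat_G2 (n : ℕ) :
    LipNat 2 ((2 : ℝ) ^ (5 * (Nat.log 2 n : ℤ) - 16 * n) * (2 : ℝ) ^ Nat.log 2 n) (G2 n) ∧
    ‖G2 n 0‖ ≤ (2 : ℝ) ^ (5 * (Nat.log 2 n : ℤ) - 16 * n) := by
  set K : ℝ := (2 : ℝ) ^ Nat.log 2 n with hK
  set E : ℝ := (2 : ℝ) ^ (5 * (Nat.log 2 n : ℤ) - 16 * n) with hE
  have hK0 : 0 ≤ K := by positivity
  have hE0 : 0 ≤ E := by positivity
  -- term 1
  have hB₁ := lipNat_bracket₁ n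
  have hT₁ : LipNat 2 (E * K) (fun m => cst₁ n * (W2 n m ^ 4 * C2 n n m ^ 4)) :=
    (hB₁.1.const_mul (cst₁ n)).mono (mul_le_mul_of_nonneg_right (norm_cst₁_le n) hK0)
  -- term 2
  have hT₂ : LipNat 2 (E * K) (fun m => ∑ l ∈ range n,
      cst₂ n l * (lin2 n m * W2 n m ^ 4 * C2 n n m ^ 3 * C2 l l m * C2 n (n - 1 - l) m)) := by
    refine LipNat.finset_sum (p := 2) (range n) (by positivity) fun l hl => ?_
    have hl' := mem_range.1 hl
    exact ((lipNat_bracket₂ n hl').1.const_mul (cst₂ n l)).mono (mul_le_mul_of_nonneg_right (norm_cst₂_le n hl') hK0)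
  -- term 3
  have hT₃ : LipNat 2 (E * K) (fun m => ∑ j ∈ range (n + 1), cst₃ n * (lin2 n m * W2 n m ^ 4 * C2 n n m ^ 4 * u2 j m)) := by
    refine LipNat.finset_sum (p := 2) (range (n + 1)) (by positivity) fun j _ => ?_
    exact ((lipNat_bracket₃ n j).1.const_mul (cst₃ n)).mono (mul_le_mul_of_nonneg_right (norm_cst₃_le n) hK0)
  refine ⟨?_, ?_⟩
  · have h := (hT₁.add hT₂).sub hT₃
    simp only [max_self] at h
    exact h
  · -- the value at `0`: every bracket has norm `≤ 1`
    rw [G2]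
    have hsub : ∀ x y : ℚ_[2], ‖x - y‖ ≤ max ‖x‖ ‖y‖ := fun x y => by
      simpa [sub_eq_add_neg, norm_neg] using IsUltrametricDist.norm_add_le_max x (-y)
    refine (hsub _ _).trans (max_le ((IsUltrametricDist.norm_add_le_max _ _).trans (max_le ?_ ?_)) ?_)
    · rw [norm_mul]
      exact (mul_le_mul (norm_cst₁_le n) (hB₁.2 0) (norm_nonneg _) hE0).trans (by rw [mul_one])
    · refine IsUltrametricDist.norm_sum_le_of_forall_le_of_nonneg hE0 fun l hl => ?_
      have hl' := mem_range.1 hl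
      rw [norm_mul]
      exact (mul_le_mul (norm_cst₂_le n hl') ((lipNat_bracket₂ n hl').2 0) (norm_nonneg _) hE0).trans (by rw [mul_one])
    · refine IsUltrametricDist.norm_sum_le_of_forall_le_of_nonneg hE0 fun j _ => ?_
      rw [norm_mul]
      exact (mul_le_mul (norm_cst₃_le n) ((lipNat_bracket₃ n j).2 0) (norm_nonneg _) hE0).trans (by rw [mul_one])

/-- **Lemma 6.2 (explicit form): `‖S_n‖₂ ≤ 2^{6⌊log₂ n⌋+1−16n}`** — Lemma 2.5 (`norm_le_of_tendsto_volkenbornSum_of_lipNat`) applied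
to the Leibniz form of `D_n = −R_n′(·+½)`. [cite: LaiSprangZudilin2026, Lemma 6.2] -/
theorem norm_S_le (n : ℕ) : ‖S n‖ ≤ (2 : ℝ) ^ (6 * (Nat.log 2 n : ℤ) + 1 - 16 * n) := by
  obtain ⟨hLip, h0⟩ := lipNat_G2 n
  have hLipD : LipNat 2 ((2 : ℝ) ^ (5 * (Nat.log 2 n : ℤ) - 16 * n) * (2 : ℝ) ^ Nat.log 2 n) (fun k : ℕ => D n k) := by
    intro k h'
    have h1 := hLip.neg k h'
    simp only [D_natCast_eq_neg_G2]
    exact h1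
  have h0D : ‖D n ((0 : ℕ) : ℤ_[2])‖ ≤ (2 : ℝ) ^ (5 * (Nat.log 2 n : ℤ) - 16 * n) := by
    rw [D_natCast_eq_neg_G2, norm_neg]; exact h0
  have hS := norm_le_of_tendsto_volkenbornSum_of_lipNat (p := 2) (by positivity) hLipD (tendsto_volkenbornSum_D_S n)
  rw [Nat.cast_zero] at h0D
  refine hS.trans (max_le (h0D.trans ?_) ?_)
  · exact zpow_le_zpow_right₀ (by norm_num) (by omega)
  · rw [← zpow_natCast, ← zpow_add₀ (by norm_num : (2 : ℝ) ≠ 0),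
      show ((2 : ℕ) : ℝ) = (2 : ℝ) ^ (1 : ℤ) by norm_num, ← zpow_add₀ (by norm_num : (2 : ℝ) ≠ 0)]
    exact zpow_le_zpow_right₀ (by norm_num) (by omega)

/-- **Lemma 6.2 as printed: `|S_n|₂ ≤ 2^{−16n+o(n)}`** — for every `ε > 0`, eventually `‖S_n‖₂ ≤ exp(−(16 log 2 − ε)n)`.
[cite: LaiSprangZudilin2026, Lemma 6.2] -/
theorem norm_S_le_exp {ε : ℝ} (hε : 0 < ε) :
    ∀ᶠ n : ℕ in atTop, ‖S n‖ ≤ Real.exp (-(16 * Real.log 2 - ε) * n) := by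
  -- `log n ≤ (ε/8) n` and `log 2 ≤ (ε/8) n` eventually
  have hlog : ∀ᶠ n : ℕ in atTop, Real.log n ≤ ε / 8 * n := by
    have h := (Real.isLittleO_log_id_atTop.natCast_atTop).def (show 0 < ε / 8 by positivity)
    filter_upwards [h] with n hn
    have h2 : ‖(n : ℝ)‖ = n := by rw [Real.norm_eq_abs, Nat.abs_cast]
    simp only [id, h2, Real.norm_eq_abs] at hn
    exact (le_abs_self _).trans hn
  have hconst : ∀ᶠ n : ℕ in atTop, Real.log 2 ≤ ε / 8 * n := by
    have h := tendsto_natCast_atTop_atTop (R := ℝ) |>.const_mul_atTop (show 0 < ε / 8 by positivity)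
    exact (h.eventually_ge_atTop (Real.log 2))
  filter_upwards [hlog, hconst, eventually_ge_atTop 1] with n hn hc hn1
  refine (norm_S_le n).trans ?_
  have hL : (Nat.log 2 n : ℝ) * Real.log 2 ≤ Real.log n := by
    have h1 : (2 : ℝ) ^ (Nat.log 2 n) ≤ n := by exact_mod_cast Nat.pow_log_le_self 2 (by omega : n ≠ 0)
    have h2 := Real.log_le_log (by positivity) h1
    rwa [Real.log_pow] at h2
  rw [← Real.rpow_intCast, Real.rpow_def_of_pos (by norm_num : (0 : ℝ) < 2), Real.exp_le_exp]
  push_cast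
  have hlog2 : 0 < Real.log 2 := Real.log_pos (by norm_num)
  have hεn : 0 ≤ ε * n := by positivity
  nlinarith [hL, hn, hc, hlog2, hεn]

end Literature.NumberTheory.Irrationality.LaiSprangZudilin2026
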